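import Literature.MathematicalPhysics.QuantumLattice.HubbardModel
import Literature.MathematicalPhysics.QuantumLattice.HubbardRectangularTorus
import Literature.MathematicalPhysics.QuantumLattice.HubbardTorus2DEnergyDensity
import Literature.MathematicalPhysics.QuantumLattice.HeisenbergModel
import Literature.MathematicalPhysics.QuantumLattice.HubbardDoubleOccupancyBounds
import Literature.MathematicalPhysics.QuantumLattice.HubbardFreeKineticLowerBound
import Literature.MathematicalPhysics.QuantumLattice.HubbardTorus2DEnergyDensityConvex
import Literature.MathematicalPhysics.QuantumLattice.HubbardEnergyDensityChemicalPotential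
import Literature.MathematicalPhysics.QuantumLattice.HubbardModelParticleHoleProofs
import Literature.MathematicalPhysics.QuantumLattice.HubbardHubbardModelEtaPairingProofs
import Literature.MathematicalPhysics.QuantumLattice.HubbardModelProofs
import HarnessLib
import HarnessLib.Audit
import Summits.HubbardSuperconductivity.ManyBodyBootstrap.Bounds.Adv1.Defs

/-!
# Many-body bootstrap — Bounds/Adv1: certificate claim nodes (new rows; see docstrings)

Part `Rows7` (1/1) of the cell's staged module `HubbardCertifiedBoundsAdv1.lean` (sha256 `04b1c8c307e9a56a…`).
Filed under the cell topic `ManyBodyBootstrap` (lit seat pub-mbboot, tool `file_parts_g19.py`; unit→part table in HOME/PLACEMENT.md);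
family map, certificate provenance (two implementations per certificate) and the PROVED soundness theorems: see part `Adv1/Defs`.
Declarations are the staged ones, byte-identical up to the namespace (`…Bounds.Adv1` → `…ManyBodyBootstrap.Bounds.Adv1`), `@[conjecture]`
on every certificate CLAIM NODE (`def … : Prop`, an open obligation node closable in-kernel from the certificate's exact data — NOT a
vendored fact) and a closing `[computation: <kind>, exact ℚ]` tag in its docstring. HONEST FRAMING: adversarial comparison against published
numerics, certified intervals only; certified numerical bounds on a lattice model; not superconductivity, not a phase diagram.
-/

noncomputable section

namespace Summit.HubbardSuperconductivity.ManyBodyBootstrap.Bounds.Adv1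

open Literature.MathematicalPhysics.QuantumLattice Literature.MathematicalPhysics.QuantumLattice.ThermodynamicLimit
open Literature.Probability.LatticeModels
open Matrix

/-- Hubbard `4×4` torus (`fermionRectTorusGraph 4 4`), `t = 1`, `U = 4`, `N = 16` (half filling), all `S^z` (`groundEnergyAt`): VARIATIONAL UPPER bound `E₀(N) ≤ -14941711340319/1099511627776` ≈ -13.5894072994 (-0.84933796/site) = outward dyadic ⌈·⌉ (k/2⁴⁰) of the EXACT rational Rayleigh quotient ⟨Ψ|H|Ψ⟩/⟨Ψ|Ψ⟩ = -13.589407299441 of the EXPLICIT state Ψ = P_(S=0) P_(K=(0,0), A1 of C4v) Φ — 1 S_z = 0 Slater determinant(s) (8↑8↓) with INTEGER orbital matrices /2^24 (`sphf_upper/state_L4_U4_s0_b24.json`, sha256 `54e61d51a4c0de28…`; orbitals VAP-optimised in floating point on the kit (j099049) and then ROUNDED — the bound is a property of the rounded state only); P_(K,Γ) = character projector over the 128 lattice automorphisms (translations × C4v), P_(S=0) = ½∫₀^π sinβ e^(−iβS_y)dβ on S^z = 0. EXACT EVALUATION by TWO INDEPENDENT IMPLEMENTATIONS agreeing bit-for-bit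 (kernels are polynomials of degree ≤ 8 in cos β, evaluated at 9 rational Pythagorean angles, interpolated/integrated in ℚ, degree checked at an extra node): A `sphf_upper/L4_U4_s0_b24_A.json` (pure Python, Bareiss–Jordan; 13 s) == B `sphf_upper/L4_U4_s0_b24_B.json` (python-flint fmpq_mat, closure-generated group, other nodes; 25 s), kit j099140 (tag mbboot); record `sphf_upper/cert_L4_U4_s0_b24.json`, index `sphf_upper/adv1g22_index.json` (sha256 `6d8db1dbb35d24e3…`), method write-up certs/README.md §gen 22. SOUNDNESS: tree `Literature.MathematicalPhysics.QuantumLattice.SymmetryProjection.rectTorus_groundEnergyAt_le_projected_div` (p221660 + p222096; [RodriguezGuzmanEtAl2012] eq. (8), χ a character of `squareSpaceGroup 4`, Q the spin-projector slot); NOT kernel-checked: 'Q = singlet projector' ([RodriguezGuzmanEtAl2012] eq. (5)) and the determinant kernel arithmetic (certificate-side, two implementations). 4×4 CALIBRATION row ([T4_N16_U4] keeps its ED-quality upper endpoint; same construction as the 6×6 endpoints). [computation: adv1 sphf-projected-determinant-upper (explicit symmetry-projected multi-determinant state; exact ℚ Rayleigh quotient, two implementations A == B), exact ℚ] -/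
@[conjecture] def sphfUpper_L4_U4_N16_L4_U4_s0_b24 : Prop :=
  E0Upper 4 4 1 (4 : ℚ) 16 ((-14941711340319 : ℚ) / 1099511627776)

/-- Hubbard `4×4` torus (`fermionRectTorusGraph 4 4`), `t = 1`, `U = 8`, `N = 16` (half filling), all `S^z` (`groundEnergyAt`): VARIATIONAL UPPER bound `E₀(N) ≤ -4634585955269/549755813888` ≈ -8.4302627425 (-0.52689142/site) = outward dyadic ⌈·⌉ (k/2⁴⁰) of the EXACT rational Rayleigh quotient ⟨Ψ|H|Ψ⟩/⟨Ψ|Ψ⟩ = -8.430262742458 of the EXPLICIT state Ψ = P_(S=0) P_(K=(0,0), A1 of C4v) Φ — 1 S_z = 0 Slater determinant(s) (8↑8↓) with INTEGER orbital matrices /2^24 (`sphf_upper/state_L4_U8_s0_b24.json`, sha256 `1bfc452bd4264a0b…`; orbitals VAP-optimised in floating point on the kit (j099096) and then ROUNDED — the bound is a property of the rounded state only); P_(K,Γ) = character projector over the 128 lattice automorphisms (translations × C4v), P_(S=0) = ½∫₀^π sinβ e^(−iβS_y)dβ on S^z = 0. EXACT EVALUATION by TWO INDEPENDENT IMPLEMENTATIONS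 agreeing bit-for-bit (kernels are polynomials of degree ≤ 8 in cos β, evaluated at 9 rational Pythagorean angles, interpolated/integrated in ℚ, degree checked at an extra node): A `sphf_upper/L4_U8_s0_b24_A.json` (pure Python, Bareiss–Jordan; 13 s) == B `sphf_upper/L4_U8_s0_b24_B.json` (python-flint fmpq_mat, closure-generated group, other nodes; 21 s), kit j099701 (tag mbboot); record `sphf_upper/cert_L4_U8_s0_b24.json`, index `sphf_upper/adv1g22_index.json` (sha256 `6d8db1dbb35d24e3…`), method write-up certs/README.md §gen 22. SOUNDNESS: tree `Literature.MathematicalPhysics.QuantumLattice.SymmetryProjection.rectTorus_groundEnergyAt_le_projected_div` (p221660 + p222096; [RodriguezGuzmanEtAl2012] eq. (8), χ a character of `squareSpaceGroup 4`, Q the spin-projector slot); NOT kernel-checked: 'Q = singlet projector' ([RodriguezGuzmanEtAl2012] eq. (5)) and the determinant kernel arithmetic (certificate-side, two implementations). 4×4 CALIBRATION row ([T4_N16_U8] keeps its ED-quality upper endpoint; same construction as the 6×6 endpoints). [computation: adv1 sphf-projected-determinant-upper (explicit symmetry-projected multi-determinant state; exact ℚ Rayleigh quotient, two implementations A == B),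 exact ℚ] -/
@[conjecture] def sphfUpper_L4_U8_N16_L4_U8_s0_b24 : Prop :=
  E0Upper 4 4 1 (8 : ℚ) 16 ((-4634585955269 : ℚ) / 549755813888)

end Summit.HubbardSuperconductivity.ManyBodyBootstrap.Bounds.Adv1

end
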